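import Literature.NumberTheory.Irrationality.Zudilin2014.SecondTaleBlockArith
import Literature.NumberTheory.Irrationality.Zudilin2014.SecondTaleDeriv

/-!
# Zudilin 2014, second tale: the inclusions (T3) and the `p̂`-half of Proposition 3

Topic `Literature/NumberTheory/Irrationality/Zudilin2014` [Zudilin2014ZetaTwo, Section 6, eq. (T3) and Proposition 3].
PROVED here, for admissible parameters (eq. (cond2), `AdmissibleT a b`):

* **eq. (T3)** [cite: Zudilin2014ZetaTwo, Section 6, eq. (T3)]: `D_M · B_k ∈ ℤ` at every pole `−k` of `R̂`, for
  `M ≥ max{â₀−b̂₀, â₁−b̂₁, b̂₃*−â₂−1, b̂₃*−â₃−1}` (`exists_int_lcm_mul_coefBT`).  The "standard consideration"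
  of the paper ([Zudilin2004OddZeta, Lemmas 1–3 and the proof of Lemma 4]) is carried out on the tree's cover-up
  definition of `B_k` (`coefBT`, quotient rule on `numT/dhatT`): at a double pole
  `B_k = numT′(−k)/dhatT(−k) − A_k·(Σ 1/(i−k))`, where `numT′(−k)/dhatT(−k)` is a binomial multiple of the block
  derivatives of [Zudilin2004OddZeta, Lemma 1] (`SecondTaleBlockArith`), and at a simple pole
  `B_k = numT(−k)/dhatT(−k)` carries the reciprocal non-pole block cleared by the beta evaluation
  ([Zudilin2004OddZeta, Lemmas 2–3]);
* **Proposition 3, second inclusion** [cite: Zudilin2014ZetaTwo, Proposition 3]: `D_{ĉ₁} D_{ĉ₂} p̂(â,b̂) ∈ ℤ` for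
  `ĉ₁ ≥ max{â₀−b̂₀, â₁−b̂₁, b̂₃*−â₂−1, b̂₃*−â₃−1, 2b̂₂*−â₀*−2}` and `ĉ₂ ≥ 2b̂₃*−â₀*−2` (`exists_int_lcm_mul_formPT`),
  from (T3), `A_k ∈ ℤ` (`coefAT_eq_cast`) and `D_c Σ_{ℓ≤m} (−1)^{ℓ−1}/ℓ^s ∈ ℤ`.
(The first inclusion `q̂ ∈ ℤ` is `formQT_eq_cast` in `SecondTale`.)

Cell pub-zeta5 (HONEST FRAMING: systematic search; no irrationality claim unless certified).
-/

noncomputable section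

open Polynomial Finset

namespace Literature.NumberTheory.Irrationality.Zudilin2014

/-- A finite sum of integers is an integer (folklore; = `DilogPade.isInt_sum`, kept `private` as in
`SecondTaleBlockArith` to avoid a cross-topic import). [cite: Zudilin2014ZetaTwo, proof of Proposition 3] -/
private theorem exists_int_sum {ι : Type*} (s : Finset ι) (f : ι → ℚ) (h : ∀ i ∈ s, ∃ z : ℤ, f i = z) :
    ∃ z : ℤ, ∑ i ∈ s, f i = z := by
  classical
  induction s using Finset.induction_on with
  | empty => exact ⟨0, by simp⟩
  | insert a s ha ih =>
    obtain ⟨z₁, hz₁⟩ := h a (mem_insert_self a s)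
    obtain ⟨z₂, hz₂⟩ := ih fun i hi => h i (mem_insert_of_mem hi)
    exact ⟨z₁ + z₂, by rw [sum_insert ha, hz₁, hz₂]; push_cast; ring⟩

/-! ### The cover-up denominator of one block -/

/-- The cover-up product of one denominator block at the pole `−k`: `∏_{i∈[lo,hi), i≠k} (i − k)`.
[cite: Zudilin2014ZetaTwo, Section 6, eq. (T2)] -/
def coverProd (lo hi k : ℤ) : ℚ := ∏ i ∈ (Ico lo hi).erase k, ((i : ℚ) - k)

/-- `dhatT(−k)` is the product of the two cover-up products. [cite: Zudilin2014ZetaTwo, Section 6, eq. (T2)] -/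
theorem eval_dhatT_eq_coverProd (a b : Fin 4 → ℤ) (k : ℤ) :
    (dhatT a b k).eval (-(k : ℚ)) = coverProd (a 2) (b 2) k * coverProd (a 3) (b 3) k := by
  unfold dhatT coverProd
  rw [eval_mul, eval_prod, eval_prod]
  have e : ∀ s : Finset ℤ, ∏ i ∈ s, ((X + C (i : ℚ)).eval (-(k : ℚ))) = ∏ i ∈ s, ((i : ℚ) - k) := fun s =>
    prod_congr rfl fun i _ => by simp; ring
  rw [e, e]

/-- The cover-up product never vanishes. [cite: Zudilin2014ZetaTwo, Section 6, eq. (T2)] -/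
theorem coverProd_ne_zero (lo hi k : ℤ) : coverProd lo hi k ≠ 0 := by
  unfold coverProd
  refine prod_ne_zero_iff.2 fun i hi => sub_ne_zero.2 ?_
  exact_mod_cast (mem_erase.1 hi).1

/-- At a pole of the block (`k ∈ [lo,hi)`): `∏_{i≠k}(i−k) = (−1)^{k−lo} (k−lo)! (hi−1−k)!`.
[cite: Zudilin2014ZetaTwo, Section 6, eq. (T2)] -/
theorem coverProd_of_mem {lo hi k : ℤ} (hk : k ∈ Ico lo hi) :
    coverProd lo hi k = (-1) ^ (k - lo).toNat * facZ (k - lo) * facZ (hi - 1 - k) := by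
  unfold coverProd; rw [prod_erase_sub_eq hk, facZ_eq, facZ_eq]

/-- **[Zudilin2004OddZeta, Lemma 3 (first inclusion)]**: at a pole of the block,
`(hi−lo−1)!/∏_{i≠k}(i−k) = ± binom(hi−lo−1, k−lo) ∈ ℤ`. [cite: Zudilin2004OddZeta, Lemma 3] -/
theorem exists_int_facZ_eq_mul_coverProd {lo hi k : ℤ} (hk : k ∈ Ico lo hi) :
    ∃ z : ℤ, facZ (hi - lo - 1) = z * coverProd lo hi k := by
  have hk' := mem_Ico.1 hk
  have hle : (k - lo).toNat ≤ (hi - lo - 1).toNat := by omega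
  have hsub : (hi - lo - 1).toNat - (k - lo).toNat = (hi - 1 - k).toNat := by omega
  have hnat : (((hi - lo - 1).toNat.choose (k - lo).toNat : ℕ) : ℚ) * ((k - lo).toNat.factorial : ℚ)
      * ((hi - 1 - k).toNat.factorial : ℚ) = ((hi - lo - 1).toNat.factorial : ℚ) := by
    rw [← hsub]; exact_mod_cast Nat.choose_mul_factorial_mul_factorial hle
  refine ⟨(-1) ^ (k - lo).toNat * ((hi - lo - 1).toNat.choose (k - lo).toNat : ℤ), ?_⟩
  rw [coverProd_of_mem hk, facZ_eq, facZ_eq, facZ_eq, ← hnat]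
  push_cast
  have h1 : ((-1 : ℚ) ^ (k - lo).toNat) * (-1) ^ (k - lo).toNat = 1 := by
    rw [← mul_pow]; norm_num
  linear_combination (-(((hi - lo - 1).toNat.choose (k - lo).toNat : ℕ) : ℚ) * ((k - lo).toNat.factorial : ℚ)
    * ((hi - 1 - k).toNat.factorial : ℚ)) * h1

/-- `x / ((−1)^n y) = (−1)^n (x / y)`. [cite: Zudilin2004OddZeta, Lemma 3 (signs)] -/
theorem div_neg_one_pow_mul (n : ℕ) (x y : ℚ) : x / ((-1) ^ n * y) = (-1) ^ n * (x / y) := by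
  rw [mul_comm ((-1 : ℚ) ^ n) y, ← div_div, div_eq_mul_inv (x / y) ((-1 : ℚ) ^ n), ← inv_pow, inv_neg_one]
  ring

/-- **[Zudilin2004OddZeta, Lemma 3 (second inclusion)] for the non-pole block**: if `k ∉ [lo,hi)` then
`D_c · (hi−lo−1)!/∏_{lo≤i<hi}(i−k) ∈ ℤ` as soon as `c ≥ hi−1−k` (`k < lo`) resp. `c ≥ k−lo` (`k ≥ hi`)
— the beta evaluation `j! r!/(j+r+1)! = Σ_i (−1)^i binom(r,i)/(j+i+1)`. [cite: Zudilin2004OddZeta, Lemmas 2–3] -/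
theorem exists_int_lcm_mul_facZ_div_coverProd {lo hi k : ℤ} (hlh : lo < hi) (hk : k ∉ Ico lo hi) {c : ℕ}
    (hc1 : k < lo → (hi - 1 - k).toNat ≤ c) (hc2 : hi ≤ k → (k - lo).toNat ≤ c) :
    ∃ z : ℤ, (Nat.lcmUpto c : ℚ) * (facZ (hi - lo - 1) / coverProd lo hi k) = z := by
  have hcp : coverProd lo hi k = ∏ i ∈ Ico lo hi, ((i : ℚ) - k) := by
    unfold coverProd; rw [erase_eq_of_notMem hk]
  rcases lt_or_ge k lo with hklo | hklo
  · -- `k < lo`: `∏_{lo≤i<hi}(i−k) = (hi−1−k)!/(lo−1−k)!`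
    have hjr : (hi - 1 - k).toNat = (lo - 1 - k).toNat + (hi - lo - 1).toNat + 1 := by omega
    have hprod : (((lo - 1 - k).toNat.factorial : ℕ) : ℚ) * ∏ i ∈ Ico lo hi, ((i : ℚ) - k)
        = ((((lo - 1 - k).toNat + (hi - lo - 1).toNat + 1).factorial : ℕ) : ℚ) := by
      have hu : Ico (k + 1) lo ∪ Ico lo hi = Ico (k + 1) hi := Ico_union_Ico_eq_Ico (by omega) hlh.le
      have hd : Disjoint (Ico (k + 1) lo) (Ico lo hi) := Ico_disjoint_Ico_consecutive _ _ _
      have e2 := prod_Ico_succ_sub_eq k hi (by omega)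
      rw [← hu, prod_union hd, prod_Ico_succ_sub_eq k lo hklo, hjr] at e2
      exact e2
    obtain ⟨z, hz⟩ := exists_int_lcm_mul_beta (lo - 1 - k).toNat (hi - lo - 1).toNat (c := c)
      (by have := hc1 hklo; omega)
    refine ⟨z, ?_⟩
    rw [← hz, hcp, facZ_eq, ← hprod]
    have hj0 : (((lo - 1 - k).toNat.factorial : ℕ) : ℚ) ≠ 0 := by exact_mod_cast Nat.factorial_ne_zero _
    rw [mul_div_mul_left _ _ hj0]
  · -- `hi ≤ k`: `∏_{lo≤i<hi}(i−k) = (−1)^m m! binom(k−lo, m)`, `m = hi − lo`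
    have hkhi : hi ≤ k := by
      by_contra h
      exact hk (mem_Ico.2 ⟨hklo, by omega⟩)
    have hm : (hi - lo).toNat = (hi - lo - 1).toNat + 1 := by omega
    have hK : (k - lo).toNat = (hi - lo - 1).toNat + (k - hi).toNat + 1 := by omega
    have hle : (hi - lo - 1).toNat + 1 ≤ (hi - lo - 1).toNat + (k - hi).toNat + 1 := by omega
    have hnat : ((((hi - lo - 1).toNat + (k - hi).toNat + 1).choose ((hi - lo - 1).toNat + 1) : ℕ) : ℚ)
        * (((hi - lo - 1).toNat + 1).factorial : ℚ) * ((k - hi).toNat.factorial : ℚ)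
        = (((hi - lo - 1).toNat + (k - hi).toNat + 1).factorial : ℚ) := by
      have hsub : (hi - lo - 1).toNat + (k - hi).toNat + 1 - ((hi - lo - 1).toNat + 1) = (k - hi).toNat := by omega
      have hcf := Nat.choose_mul_factorial_mul_factorial hle
      rw [hsub] at hcf
      exact_mod_cast hcf
    obtain ⟨z, hz⟩ := exists_int_lcm_mul_beta (hi - lo - 1).toNat (k - hi).toNat (c := c)
      (by have := hc2 hkhi; omega)
    refine ⟨(-1) ^ ((hi - lo - 1).toNat + 1) * z, ?_⟩
    rw [hcp, prod_Ico_sub_eq lo hi k hlh.le hkhi, hm, hK, facZ_eq, mul_assoc ((-1 : ℚ) ^ _), div_neg_one_pow_mul]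
    push_cast
    rw [← hz]
    have hC : ((((hi - lo - 1).toNat + (k - hi).toNat + 1).choose ((hi - lo - 1).toNat + 1) : ℕ) : ℚ) ≠ 0 := by
      have : 0 < ((hi - lo - 1).toNat + (k - hi).toNat + 1).choose ((hi - lo - 1).toNat + 1) := Nat.choose_pos hle
      exact_mod_cast this.ne'
    have hf := fun n : ℕ => (Nat.cast_ne_zero (R := ℚ)).2 (Nat.factorial_ne_zero n)
    have hr := hf (k - hi).toNat
    have hj1 := hf ((hi - lo - 1).toNat + 1)
    have hjr1 := hf ((hi - lo - 1).toNat + (k - hi).toNat + 1)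
    rw [← hnat, Nat.factorial_succ (hi - lo - 1).toNat]
    push_cast
    field_simp

/-! ### The numerator at a pole -/

/-- `block2(−k) = (â₀−b̂₀)! · binom` (an integer multiple of the factorial). [cite: Zudilin2004OddZeta, Lemma 1] -/
theorem eval_block2_neg_intCast {a b : Fin 4 → ℤ} (hab : AdmissibleT a b) (k : ℤ) :
    (block2 (b 0) (a 0)).eval (-(k : ℚ)) = facZ (a 0 - b 0) * (zb (b 0) (a 0) (-(2 * k)) : ℚ) := by
  rw [eval_block2_eq, show (2 : ℚ) * -(k : ℚ) = ((-(2 * k) : ℤ) : ℚ) by push_cast; ring,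
    eval_block_intCast _ _ _ hab.b0_le_a0, facZ_eq]

/-- `block1(−k) = (â₁−b̂₁)! · binom`. [cite: Zudilin2004OddZeta, Lemma 1] -/
theorem eval_block1_neg_intCast {a b : Fin 4 → ℤ} (hab : AdmissibleT a b) (k : ℤ) :
    (block (b 1) (a 1)).eval (-(k : ℚ)) = facZ (a 1 - b 1) * (zb (b 1) (a 1) (-k) : ℚ) := by
  rw [show -(k : ℚ) = ((-k : ℤ) : ℚ) by push_cast; ring, eval_block_intCast _ _ _ (hab.b1_le 1 (by decide)),
    facZ_eq]

/-- `numT(−k) = (b̂₂−â₂−1)! (b̂₃−â₃−1)! · binom · binom`. [cite: Zudilin2014ZetaTwo, Section 6, eq. (T2)] -/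
theorem eval_numT_neg_intCast {a b : Fin 4 → ℤ} (hab : AdmissibleT a b) (k : ℤ) :
    (numT a b).eval (-(k : ℚ)) = facZ (b 2 - a 2 - 1) * facZ (b 3 - a 3 - 1)
      * ((zb (b 0) (a 0) (-(2 * k)) : ℚ) * (zb (b 1) (a 1) (-k) : ℚ)) := by
  unfold numT normT
  rw [eval_mul, eval_C, eval_mul, eval_block2_neg_intCast hab, eval_block1_neg_intCast hab]
  have f0 : facZ (a 0 - b 0) ≠ 0 := by rw [facZ_eq]; exact_mod_cast Nat.factorial_ne_zero _
  have f1 : facZ (a 1 - b 1) ≠ 0 := by rw [facZ_eq]; exact_mod_cast Nat.factorial_ne_zero _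
  field_simp

/-- **[Zudilin2004OddZeta, Lemma 1] for the numerator**: `D_c · numT′(−k) ∈ (b̂₂−â₂−1)!(b̂₃−â₃−1)!·ℤ` for
`c ≥ â₀−b̂₀, â₁−b̂₁` (product rule + the block-derivative inclusions). [cite: Zudilin2004OddZeta, Lemma 1] -/
theorem exists_int_lcm_mul_eval_derivative_numT {a b : Fin 4 → ℤ} (hab : AdmissibleT a b) (k : ℤ) {c : ℕ}
    (h0 : (a 0 - b 0).toNat ≤ c) (h1 : (a 1 - b 1).toNat ≤ c) :
    ∃ z : ℤ, (Nat.lcmUpto c : ℚ) * (derivative (numT a b)).eval (-(k : ℚ))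
      = facZ (b 2 - a 2 - 1) * facZ (b 3 - a 3 - 1) * z := by
  obtain ⟨z₂, hz₂⟩ := exists_int_lcm_mul_derivative_block2 hab.b0_le_a0 (t := -(k : ℚ)) (s := -(2 * k))
    (by push_cast; ring) h0
  obtain ⟨z₁, hz₁⟩ := exists_int_lcm_mul_derivative_block (hab.b1_le 1 (by decide)) (-k) h1
  have hcast : (((-k : ℤ)) : ℚ) = -(k : ℚ) := by push_cast; ring
  rw [hcast] at hz₁
  refine ⟨z₂ * zb (b 1) (a 1) (-k) + zb (b 0) (a 0) (-(2 * k)) * z₁, ?_⟩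
  have key : (Nat.lcmUpto c : ℚ) * (derivative (numT a b)).eval (-(k : ℚ))
      = normT a b * (((Nat.lcmUpto c : ℚ) * (derivative (block2 (b 0) (a 0))).eval (-(k : ℚ)))
          * (block (b 1) (a 1)).eval (-(k : ℚ))
        + (block2 (b 0) (a 0)).eval (-(k : ℚ))
          * ((Nat.lcmUpto c : ℚ) * (derivative (block (b 1) (a 1))).eval (-(k : ℚ)))) := by
    unfold numT
    rw [derivative_C_mul, derivative_mul, eval_mul, eval_C, eval_add, eval_mul, eval_mul]
    ring
  rw [key, hz₂, hz₁, eval_block2_neg_intCast hab, eval_block1_neg_intCast hab]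
  unfold normT
  have f0 : facZ (a 0 - b 0) ≠ 0 := by rw [facZ_eq]; exact_mod_cast Nat.factorial_ne_zero _
  have f1 : facZ (a 1 - b 1) ≠ 0 := by rw [facZ_eq]; exact_mod_cast Nat.factorial_ne_zero _
  push_cast
  field_simp

/-- `D_c Σ_{i∈[lo,hi)∖k} 1/(i−k) ∈ ℤ` at a pole of the block, `c ≥ hi−lo−1` ("definition of the least common
multiple"). [cite: Zudilin2004OddZeta, proof of Lemma 4] -/
theorem exists_int_lcm_mul_sum_inv {lo hi k : ℤ} (hk : k ∈ Ico lo hi) {c : ℕ} (hc : (hi - lo - 1).toNat ≤ c) :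
    ∃ z : ℤ, (Nat.lcmUpto c : ℚ) * ∑ i ∈ (Ico lo hi).erase k, 1 / ((i : ℚ) - k) = z := by
  rw [mul_sum]
  refine exists_int_sum _ _ fun i hi => ?_
  have hik := mem_erase.1 hi
  have hi' := mem_Ico.1 hik.2
  have hk' := mem_Ico.1 hk
  obtain ⟨z, hz⟩ := exists_int_lcm_div_intCast (e := i - k) (c := c) (sub_ne_zero.2 hik.1) (by omega)
  exact ⟨z, by rw [← hz]; push_cast; ring⟩

/-! ### Eq. (T3) -/

/-- **Zudilin 2014, eq. (T3)** [cite: Zudilin2014ZetaTwo, Section 6, eq. (T3)]: at every pole `−k` of `R̂`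
(`k ∈ [â₂,b̂₂) ∪ [â₃,b̂₃)`), `D_c · B_k ∈ ℤ` whenever `c ≥ â₀−b̂₀, â₁−b̂₁, b̂₃*−â₂−1, b̂₃*−â₃−1`
("standard consideration; see Lemma 3 and the proof of Lemma 4 in [Zu04]" = [Zudilin2004OddZeta]). -/
theorem exists_int_lcm_mul_coefBT {a b : Fin 4 → ℤ} (hab : AdmissibleT a b) {k : ℤ}
    (hk : k ∈ Ico (a 2) (b 2) ∨ k ∈ Ico (a 3) (b 3)) {c : ℕ}
    (h0 : (a 0 - b 0).toNat ≤ c) (h1 : (a 1 - b 1).toNat ≤ c)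
    (h2 : (bMax b - a 2 - 1).toNat ≤ c) (h3 : (bMax b - a 3 - 1).toNat ≤ c) :
    ∃ z : ℤ, (Nat.lcmUpto c : ℚ) * coefBT a b k = z := by
  have ha2 := hab.a_lt 2 (by decide)
  have ha3 := hab.a_lt 3 (by decide)
  have hbM2 : b 2 ≤ bMax b := le_max_left _ _
  have hbM3 : b 3 ≤ bMax b := le_max_right _ _
  have hN := eval_numT_neg_intCast hab k
  have hd := eval_dhatT_eq_coverProd a b k
  have hE2 := coverProd_ne_zero (a 2) (b 2) k
  have hE3 := coverProd_ne_zero (a 3) (b 3) k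
  have hD : (Nat.lcmUpto c : ℚ) ≠ 0 := by exact_mod_cast (Nat.lcmUpto_pos c).ne'
  by_cases h2m : k ∈ Ico (a 2) (b 2) <;> by_cases h3m : k ∈ Ico (a 3) (b 3)
  · -- double pole: `B_k = numT′(−k)/dhatT(−k) − A_k · (Σ₂ + Σ₃)`
    have hk2 := mem_Ico.1 h2m
    have hk3 := mem_Ico.1 h3m
    obtain ⟨w2, hw2⟩ := exists_int_facZ_eq_mul_coverProd h2m
    obtain ⟨w3, hw3⟩ := exists_int_facZ_eq_mul_coverProd h3m
    obtain ⟨z, hz⟩ := exists_int_lcm_mul_eval_derivative_numT hab k h0 h1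
    obtain ⟨s2, hs2⟩ := exists_int_lcm_mul_sum_inv h2m (c := c) (by omega)
    obtain ⟨s3, hs3⟩ := exists_int_lcm_mul_sum_inv h3m (c := c) (by omega)
    refine ⟨w2 * w3 * (z - zb (b 0) (a 0) (-(2 * k)) * zb (b 1) (a 1) (-k) * (s2 + s3)), ?_⟩
    have hN' : (derivative (numT a b)).eval (-(k : ℚ))
        = facZ (b 2 - a 2 - 1) * facZ (b 3 - a 3 - 1) * z / Nat.lcmUpto c := by
      rw [eq_div_iff hD, mul_comm]; exact hz
    have hS2 : ∑ i ∈ (Ico (a 2) (b 2)).erase k, 1 / ((i : ℚ) - k) = s2 / Nat.lcmUpto c := by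
      rw [eq_div_iff hD, mul_comm]; exact hs2
    have hS3 : ∑ i ∈ (Ico (a 3) (b 3)).erase k, 1 / ((i : ℚ) - k) = s3 / Nat.lcmUpto c := by
      rw [eq_div_iff hD, mul_comm]; exact hs3
    unfold coefBT
    rw [qpolyT_eq_of_double h2m h3m, eval_derivative_dhatT_eq, hd, hN, hN', hS2, hS3, hw2, hw3]
    push_cast
    field_simp
  · -- simple pole in the block `[â₂, b̂₂)`, `k ∉ [â₃, b̂₃)`
    have hk2 := mem_Ico.1 h2m
    have hm : multT a b k = 1 := by unfold multT; rw [if_pos h2m, if_neg h3m]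
    obtain ⟨w2, hw2⟩ := exists_int_facZ_eq_mul_coverProd h2m
    obtain ⟨v3, hv3⟩ := exists_int_lcm_mul_facZ_div_coverProd (lo := a 3) (hi := b 3) (k := k) (by omega) h3m
      (c := c) (fun h => by omega) (fun h => by rw [mem_Ico] at h3m; omega)
    refine ⟨w2 * v3 * zb (b 0) (a 0) (-(2 * k)) * zb (b 1) (a 1) (-k), ?_⟩
    rw [coefBT_of_simple hm, hd, hN, hw2]
    have e : (Nat.lcmUpto c : ℚ) * ((w2 : ℚ) * coverProd (a 2) (b 2) k * facZ (b 3 - a 3 - 1)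
          * ((zb (b 0) (a 0) (-(2 * k)) : ℚ) * (zb (b 1) (a 1) (-k) : ℚ))
          / (coverProd (a 2) (b 2) k * coverProd (a 3) (b 3) k))
        = (w2 : ℚ) * ((zb (b 0) (a 0) (-(2 * k)) : ℚ) * (zb (b 1) (a 1) (-k) : ℚ))
          * ((Nat.lcmUpto c : ℚ) * (facZ (b 3 - a 3 - 1) / coverProd (a 3) (b 3) k)) := by
      field_simp
    rw [e, hv3]; push_cast; ring
  · -- simple pole in the block `[â₃, b̂₃)`, `k ∉ [â₂, b̂₂)`
    have hk3 := mem_Ico.1 h3m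
    have hm : multT a b k = 1 := by unfold multT; rw [if_neg h2m, if_pos h3m]
    obtain ⟨w3, hw3⟩ := exists_int_facZ_eq_mul_coverProd h3m
    obtain ⟨v2, hv2⟩ := exists_int_lcm_mul_facZ_div_coverProd (lo := a 2) (hi := b 2) (k := k) (by omega) h2m
      (c := c) (fun h => by omega) (fun h => by rw [mem_Ico] at h2m; omega)
    refine ⟨v2 * w3 * zb (b 0) (a 0) (-(2 * k)) * zb (b 1) (a 1) (-k), ?_⟩
    rw [coefBT_of_simple hm, hd, hN, hw3]
    have e : (Nat.lcmUpto c : ℚ) * (facZ (b 2 - a 2 - 1) * ((w3 : ℚ) * coverProd (a 3) (b 3) k)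
          * ((zb (b 0) (a 0) (-(2 * k)) : ℚ) * (zb (b 1) (a 1) (-k) : ℚ))
          / (coverProd (a 2) (b 2) k * coverProd (a 3) (b 3) k))
        = (w3 : ℚ) * ((zb (b 0) (a 0) (-(2 * k)) : ℚ) * (zb (b 1) (a 1) (-k) : ℚ))
          * ((Nat.lcmUpto c : ℚ) * (facZ (b 2 - a 2 - 1) / coverProd (a 2) (b 2) k)) := by
      field_simp
    rw [e, hv2]; push_cast; ring
  · exact absurd hk (by tauto)

/-! ### Proposition 3, the inclusion for `p̂` -/

/-- `D_c Σ_{ℓ≤m} (−1)^{ℓ−1}/ℓ ∈ ℤ` for `m ≤ c`. [cite: Zudilin2014ZetaTwo, proof of Proposition 3] -/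
theorem exists_int_lcm_mul_harmAlt1 {m c : ℕ} (h : m ≤ c) : ∃ z : ℤ, (Nat.lcmUpto c : ℚ) * harmAlt1 m = z := by
  unfold harmAlt1
  rw [mul_sum]
  refine exists_int_sum _ _ fun l hl => ?_
  have hl' := mem_range.1 hl
  obtain ⟨q, hq⟩ := exists_int_lcm_div_natCast (d := l + 1) (c := c) (by omega) (by omega)
  refine ⟨(-1) ^ l * q, ?_⟩
  push_cast at hq ⊢
  rw [← hq]; ring

/-- `D_{c₁} D_{c₂} Σ_{ℓ≤m} (−1)^{ℓ−1}/ℓ² ∈ ℤ` for `m ≤ c₁, c₂`. [cite: Zudilin2014ZetaTwo, proof of Proposition 3] -/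
theorem exists_int_lcm_mul_harmAlt2 {m c₁ c₂ : ℕ} (h1 : m ≤ c₁) (h2 : m ≤ c₂) :
    ∃ z : ℤ, (Nat.lcmUpto c₁ : ℚ) * Nat.lcmUpto c₂ * harmAlt2 m = z := by
  unfold harmAlt2
  rw [mul_sum]
  refine exists_int_sum _ _ fun l hl => ?_
  have hl' := mem_range.1 hl
  obtain ⟨q₁, hq₁⟩ := exists_int_lcm_div_natCast (d := l + 1) (c := c₁) (by omega) (by omega)
  obtain ⟨q₂, hq₂⟩ := exists_int_lcm_div_natCast (d := l + 1) (c := c₂) (by omega) (by omega)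
  refine ⟨(-1) ^ l * q₁ * q₂, ?_⟩
  push_cast at hq₁ hq₂ ⊢
  rw [← hq₁, ← hq₂]
  have hl1 : (l : ℚ) + 1 ≠ 0 := by positivity
  field_simp

/-- Every index of the `B`-range `[â₂*, b̂₃*)` is a pole of `R̂`'s denominator.
[cite: Zudilin2014ZetaTwo, Section 6 (poles of R̂)] -/
theorem mem_pole_of_mem_rangeB {a b : Fin 4 → ℤ} (hab : AdmissibleT a b) {k : ℤ} (hk : k ∈ Ico (aMid a) (bMax b)) :
    k ∈ Ico (a 2) (b 2) ∨ k ∈ Ico (a 3) (b 3) := by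
  rw [mem_Ico, mem_Ico]
  have hkr := mem_Ico.1 hk
  have ha2 := hab.a_lt 2 (by decide)
  have ha3 := hab.a_lt 3 (by decide)
  have hmid : min (a 2) (a 3) ≤ aMid a := by unfold aMid; omega
  have hmax : bMax b = max (b 2) (b 3) := rfl
  omega

/-- **Zudilin 2014, Proposition 3 (inclusion for `p̂`)** [cite: Zudilin2014ZetaTwo, Proposition 3]:
`D_{ĉ₁} D_{ĉ₂} · p̂(â,b̂) ∈ ℤ` for `ĉ₁ ≥ max{â₀−b̂₀, â₁−b̂₁, b̂₃*−â₂−1, b̂₃*−â₃−1, 2b̂₂*−â₀*−2}` and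
`ĉ₂ ≥ 2b̂₃*−â₀*−2`. -/
theorem exists_int_lcm_mul_formPT {a b : Fin 4 → ℤ} (hab : AdmissibleT a b) {c₁ c₂ : ℕ}
    (h0 : (a 0 - b 0).toNat ≤ c₁) (h1 : (a 1 - b 1).toNat ≤ c₁)
    (h2 : (bMax b - a 2 - 1).toNat ≤ c₁) (h3 : (bMax b - a 3 - 1).toNat ≤ c₁)
    (h4 : (2 * bMin b - a0star a - 2).toNat ≤ c₁) (h5 : (2 * bMax b - a0star a - 2).toNat ≤ c₂) :
    ∃ z : ℤ, ((Nat.lcmUpto c₁ * Nat.lcmUpto c₂ : ℕ) : ℚ) * formPT a b = z := by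
  have hmm : bMin b ≤ bMax b := min_le_max
  obtain ⟨zA, hzA⟩ : ∃ z : ℤ, (Nat.lcmUpto c₁ : ℚ) * Nat.lcmUpto c₂
      * ∑ k ∈ Ico (aMax3 a) (bMin b), 2 * coefAT a b k * harmAlt2 (2 * k - a0star a).toNat = z := by
    rw [mul_sum]
    refine exists_int_sum _ _ fun k hk => ?_
    obtain ⟨hk2, hk3, hk1⟩ := mem_double_of_mem_range hk
    have hkr := mem_Ico.1 hk
    have hb0 := hab.b0_le 2 (by decide)
    have hk2' := mem_Ico.1 hk2
    have hA := coefAT_eq_cast hab hk2 hk3 hk1 (by omega)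
    obtain ⟨zh, hzh⟩ := exists_int_lcm_mul_harmAlt2 (m := (2 * k - a0star a).toNat) (c₁ := c₁) (c₂ := c₂)
      (by omega) (by omega)
    refine ⟨2 * coefATZ a b k * zh, ?_⟩
    rw [hA]; push_cast; rw [← hzh]; ring
  obtain ⟨zB, hzB⟩ : ∃ z : ℤ, (Nat.lcmUpto c₁ : ℚ) * Nat.lcmUpto c₂
      * ∑ k ∈ Ico (aMid a) (bMax b), coefBT a b k * harmAlt1 (2 * k - a0star a).toNat = z := by
    rw [mul_sum]
    refine exists_int_sum _ _ fun k hk => ?_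
    have hkr := mem_Ico.1 hk
    obtain ⟨z1, hz1⟩ := exists_int_lcm_mul_coefBT hab (mem_pole_of_mem_rangeB hab hk) h0 h1 h2 h3
    obtain ⟨z2, hz2⟩ := exists_int_lcm_mul_harmAlt1 (m := (2 * k - a0star a).toNat) (c := c₂) (by omega)
    refine ⟨z1 * z2, ?_⟩
    push_cast; rw [← hz1, ← hz2]; ring
  refine ⟨(-1) ^ (b 2 + b 3).natAbs * (zA + zB), ?_⟩
  unfold formPT signT
  push_cast
  rw [← hzA, ← hzB]; ring

end Literature.NumberTheory.Irrationality.Zudilin2014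

end
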